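import Literature.AlgebraicGeometry.Motives.FrobIntegralPartEqFrobeniusPowerFixed
import Mathlib.RingTheory.Polynomial.GaussLemma
import Mathlib.LinearAlgebra.Semisimple
import HarnessLib

/-!
# Milne–Ramachandran 2006, Remark 1.4: `F^r_b Hⁱ(X)` is the LARGEST `ϖ`-stable subspace with
# effective semisimple `r`-th twist — the supremum is attained; `ϖ` acts semisimply on it; it is
# a `Γ_k`-submodule

Topic `Literature/AlgebraicGeometry/Motives`; THEOREMS ONLY (no definition, no instance, no named
fact; D-0026).

J. S. Milne, N. Ramachandran, *Motivic complexes over finite fields and the ring of correspondences at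
the generic point*, arXiv:math/0607483 [MilneRamachandran2006] §1 (held text, chunk p0003 L77–L88),
Rem. 1.4: «For any `i` and `r`, the set of eigenvalues `α` of `ϖ_X` on `Hⁱ_l(X)` such that `α/q^r` is an
algebraic integer is stable under Galois conjugation. Therefore, there is a subspace `F^r_b Hⁱ_l(X)` of
`Hⁱ_l(X)` that becomes the sum of the eigenspaces of these `α` over `ℚ_l^{al}`. **It is the largest
semisimple Tate substructure of `Hⁱ_l(X)` whose twist by `ℚ_l(r)` is still effective**», and §1.1
(L31–L45): «When the eigenvalues are all […] algebraic integers, resp. semisimple, we say that `V` is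
[…] effective, resp. semisimple.»

The tree renders Rem. 1.4 inside `K` (`Motives/GeneralizedTateConjecture`):
`E.IsEffectiveTwistSubspace X i r V` := «`V` is `ϖ`-stable and `ϖ_r := (q⁻¹)^r • ϖ` is killed on `V`
by a MONIC INTEGER polynomial that is SQUAREFREE over `ℚ`», and `E.frobIntegralPart X i r = F^r_b Hⁱ(X)`
:= the SUPREMUM of these `V`.  That the supremum is itself such a `V` — Rem. 1.4's «the largest» — is
a statement with content (two effective-twist subspaces have an effective-twist sum), proved here for
the abstract `E : GaloisWeilCohomology k K χ` over a finite field `k` and `X` smooth projective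
(finite-dimensional `Hⁱ(X)`), with NO Riemann-hypothesis input (contrast row g39-#8
`isEffectiveTwistSubspace_frobIntegralPart`, which needs it and `i = 2r`):

* §1 (Gauss's lemma) **two monic integer polynomials squarefree over `ℚ` have a common multiple of
  the same kind** (`exists_monic_squarefree_dvd_dvd`): `Q = Q₁ · (Q₂ / gcd(Q₁, Q₂))`, the monic
  cofactor being integral by Gauss's lemma (Mathlib `IsIntegrallyClosed.eq_map_mul_C_of_dvd`) and `Q`
  squarefree because `Q₁` and `Q₂ / gcd` are coprime (a common divisor `d` gives `d² ∣ Q₂`).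
* §2 **effective-twist subspaces are closed under `⊥`, binary `⊔`, and translation by `ρ(g)`,
  `g ∈ Γ_k`** (`isEffectiveTwistSubspace_bot`, `IsEffectiveTwistSubspace.sup`,
  `IsEffectiveTwistSubspace.map_ρ` — `Γ_k` is abelian over a finite field, so `ρ(g)` commutes with
  `ϖ = ρ(F)`, the tree's `commute_ρ`).
* §3 **REM. 1.4 «the largest»**: for `X` smooth projective, `F^r_b Hⁱ(X)` is the GREATEST
  effective-twist subspace (`isGreatest_frobIntegralPart`: a nonempty sup-closed family of subspaces
  of a finite-dimensional space contains its supremum), so ONE monic integer polynomial squarefree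
  over `ℚ` kills `ϖ_r` on `F^r_b Hⁱ(X)` (`exists_monic_squarefree_aeval_eq_zero_on_frobIntegralPart`),
  **`ϖ_r` and `ϖ` act semisimply on `F^r_b Hⁱ(X)`** («semisimple Tate substructure»;
  `isSemisimple_restrict_smul_frobenius_frobIntegralPart`, `isSemisimple_restrict_frobenius_frobIntegralPart`,
  Mathlib `Module.End.isSemisimple_of_squarefree_aeval_eq_zero`), and **`F^r_b Hⁱ(X)` is a
  `Γ_k`-submodule of `Hⁱ(X)`** for every `k`-scheme `X` (`ρ_apply_mem_frobIntegralPart`,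
  `frobIntegralPart_mem_invtSubmodule_ρ`; «Tate substructure»).

What is NOT here: the description of `F_b ⊗ ℚ_l^{al}` as a sum of eigenspaces (Rem. 1.4, first
sentence) and anything on `F_a` (the coniveau side).  HC is not touched.

## References

* [MilneRamachandran2006] J. S. Milne, N. Ramachandran, arXiv:math/0607483, §1.1 and Rem. 1.4.
* [Tate1994] J. Tate, *Conjectures on algebraic cycles in ℓ-adic cohomology*, §1.
* [SerreLocalFields1979] J.-P. Serre, *Local Fields*, Ch. XIII §1 (`Gal(𝔽̄_q/𝔽_q) ≅ Ẑ` is abelian).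

## Provenance

Lane `lit-hodgefound` (summit `HodgeConjecture`, Track 2 foundations library, Layer B: motives),
seat `lit-hodgefound-p29` (literature-prover, generation 39, row g39-#9).
-/

noncomputable section

open Polynomial

universe u v

namespace Literature.AlgebraicGeometry.Motives

/-! ### §1 A common monic integral multiple, squarefree over `ℚ` (Gauss's lemma) -/

section Gauss

/-- **Two monic integer polynomials that are squarefree over `ℚ` have a common multiple (over `ℚ`)
which is again monic, integral and squarefree over `ℚ`**: `Q = Q₁ · H` with `H` the monic cofactor of
`gcd(Q₁, Q₂)` in `Q₂`, integral by Gauss's lemma; `Q₁` and `H` are coprime since a common divisor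
`d` has `d² ∣ gcd · H = Q₂`.  (The polynomial behind «the sum of two effective semisimple Tate
substructures is one», Rem. 1.4.) [cite: MilneRamachandran2006, §1 Rem. 1.4] -/
theorem exists_monic_squarefree_dvd_dvd {Q₁ Q₂ : ℤ[X]} (h₁ : Q₁.Monic) (h₂ : Q₂.Monic)
    (hs₁ : Squarefree (Q₁.map (Int.castRingHom ℚ)))
    (hs₂ : Squarefree (Q₂.map (Int.castRingHom ℚ))) :
    ∃ Q : ℤ[X], Q.Monic ∧ Squarefree (Q.map (Int.castRingHom ℚ)) ∧
      Q₁.map (Int.castRingHom ℚ) ∣ Q.map (Int.castRingHom ℚ) ∧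
      Q₂.map (Int.castRingHom ℚ) ∣ Q.map (Int.castRingHom ℚ) := by
  classical
  set A := Q₁.map (Int.castRingHom ℚ) with hA
  set B := Q₂.map (Int.castRingHom ℚ) with hB
  have hBm : B.Monic := h₂.map _
  have hB0 : B ≠ 0 := hBm.ne_zero
  -- `G = gcd(A, B)`, `B = G * H₀`, `H` = the monic multiple of `H₀`
  set G := EuclideanDomain.gcd A B with hGdef
  have hGA : G ∣ A := EuclideanDomain.gcd_dvd_left _ _
  obtain ⟨H₀, hH₀⟩ : G ∣ B := EuclideanDomain.gcd_dvd_right _ _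
  have hH₀0 : H₀ ≠ 0 := fun h ↦ hB0 (by rw [hH₀, h, mul_zero])
  have hlc : H₀.leadingCoeff ≠ 0 := leadingCoeff_ne_zero.mpr hH₀0
  set H := H₀ * C (H₀.leadingCoeff)⁻¹ with hHdef
  have hHm : H.Monic := monic_mul_leadingCoeff_inv hH₀0
  have hH₀H : H₀ = H * C H₀.leadingCoeff := by
    rw [hHdef, mul_assoc, ← C_mul, inv_mul_cancel₀ hlc, C_1, mul_one]
  have hGHB : G * H ∣ B := ⟨C H₀.leadingCoeff, by rw [hH₀, mul_assoc, ← hH₀H]⟩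
  have hHB : H ∣ B := (dvd_mul_left H G).trans hGHB
  -- Gauss: the monic divisor `H` of `B = Q₂ ⊗ ℚ` is integral
  have hHB' : H ∣ Q₂.map (algebraMap ℤ ℚ) := hHB
  obtain ⟨H', hH'⟩ := IsIntegrallyClosed.eq_map_mul_C_of_dvd ℚ h₂ hHB'
  rw [hHm.leadingCoeff, C_1, mul_one] at hH'
  have hH'map : H'.map (Int.castRingHom ℚ) = H := hH'
  have hH'm : H'.Monic :=
    monic_of_injective (Int.castRingHom ℚ).injective_int (by rw [hH'map]; exact hHm)
  refine ⟨Q₁ * H', h₁.mul hH'm, ?_, ?_, ?_⟩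
  · -- squarefree: `A` and `H` are coprime squarefree
    rw [Polynomial.map_mul, hH'map]
    refine squarefree_mul_iff.mpr ⟨fun d hdA hdH ↦ ?_, hs₁, hs₂.squarefree_of_dvd hHB⟩
    have hdG : d ∣ G := EuclideanDomain.dvd_gcd hdA (hdH.trans hHB)
    exact hs₂ d ((mul_dvd_mul hdG hdH).trans hGHB)
  · rw [Polynomial.map_mul]
    exact dvd_mul_right _ _
  · rw [Polynomial.map_mul, hH'map]
    obtain ⟨M, hM⟩ := hGA
    refine ⟨M * C (H₀.leadingCoeff)⁻¹, ?_⟩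
    rw [← hA, hM, hH₀, hHdef]
    ring

end Gauss

/-! ### §1b Two private lemmas on polynomials in an endomorphism -/

section Pure

/-- An endomorphism commuting with `f` commutes with every polynomial in `f` (a private copy of the
argument of `Deligne1982/WeilTypeCMGeneralMemberLefschetzGroup`'s `commute_aeval_of_commute'`).
[folklore] -/
private theorem commute_aeval_of_commute {K : Type*} [CommSemiring K] {A : Type*} [Ring A] [Algebra K A]
    {g f : A} (h : Commute g f) (P : K[X]) : Commute g (aeval f P) := by
  rw [aeval_eq_sum_range]
  exact Commute.sum_right _ _ _ fun n _ ↦ (h.pow_right n).smul_right _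

/-- A polynomial in the restriction of an endomorphism to a stable subspace is the restriction of the
polynomial (on elements); private copy of the tree's `coe_aeval_restrict_apply` of
`HodgeTheory/AbelianVarietyCyclotomicAutomorphismIntegralFreeLattice` (not imported here: unrelated
heavy imports). [folklore] -/
private theorem coe_aeval_restrict_apply {K : Type*} [Field K] {V : Type*} [AddCommGroup V]
    [Module K V] {f : Module.End K V}
    {p : Submodule K V} (hf : ∀ x ∈ p, f x ∈ p) (P : K[X]) (v : p) :
    ((aeval (f.restrict hf) P) v : V) = aeval f P (v : V) := by
  induction P using Polynomial.induction_on' with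
  | add P Q hP hQ => simp only [map_add, LinearMap.add_apply, Submodule.coe_add, hP, hQ]
  | monomial n a =>
    simp only [aeval_monomial, LinearMap.smul_apply, Submodule.coe_smul,
      ← Algebra.smul_def, Module.End.pow_restrict n hf, LinearMap.coe_restrict_apply]

end Pure

/-! ### §2 Effective-twist subspaces: `⊥`, binary suprema, Galois translates -/

namespace GaloisWeilCohomology

variable {k : Type u} [Field k] [Finite k] {K : Type v} [Field K] [CharZero K]
  {χ : Field.absoluteGaloisGroup k →* Kˣ} (E : GaloisWeilCohomology k K χ)
variable {d : ℕ} {X : SchemeOver k}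

/-- Bookkeeping: `(Q ⊗ ℚ) ⊗ K = Q ⊗ K` for an integer polynomial `Q`. [folklore] -/
private theorem map_map_intCast_ratCast (Q : ℤ[X]) :
    (Q.map (Int.castRingHom ℚ)).map (algebraMap ℚ K) = Q.map (Int.castRingHom K) := by
  rw [Polynomial.map_map]
  congr 1
  exact RingHom.ext_int _ _

/-- A polynomial in `f` applied to `v` vanishes as soon as a divisor (over `ℚ`) of it kills `v`.
[folklore] -/
private theorem aeval_apply_eq_zero_of_dvd {V : Type*} [AddCommGroup V] [Module K V] (f : Module.End K V)
    {Q₁ Q : ℤ[X]} (hdvd : Q₁.map (Int.castRingHom ℚ) ∣ Q.map (Int.castRingHom ℚ)) {v : V}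
    (hv : aeval f (Q₁.map (Int.castRingHom K)) v = 0) :
    aeval f (Q.map (Int.castRingHom K)) v = 0 := by
  obtain ⟨M, hM⟩ := hdvd
  have hK : Q.map (Int.castRingHom K) = M.map (algebraMap ℚ K) * Q₁.map (Int.castRingHom K) := by
    rw [← map_map_intCast_ratCast, hM, Polynomial.map_mul, map_map_intCast_ratCast, mul_comm]
  rw [hK, map_mul, Module.End.mul_apply, hv, map_zero]

/-- **`0` is an effective-twist subspace** (killed by `T`). [cite: MilneRamachandran2006, §1 Rem. 1.4] -/
theorem isEffectiveTwistSubspace_bot (X : SchemeOver k) (i r : ℕ) :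
    E.IsEffectiveTwistSubspace X i r ⊥ := by
  refine ⟨fun v hv ↦ ?_, ⟨Polynomial.X, monic_X, ?_, fun v hv ↦ ?_⟩⟩
  · rw [(Submodule.mem_bot K).mp hv, map_zero]; exact Submodule.zero_mem _
  · rw [Polynomial.map_X]; exact separable_X.squarefree
  · rw [(Submodule.mem_bot K).mp hv, map_zero]

variable {E} in
/-- **The sum of two effective-twist subspaces is an effective-twist subspace** (Rem. 1.4: the sum of
two `ϖ`-stable subspaces with effective semisimple twist is one — killed by the common monic integral
squarefree multiple of §1). [cite: MilneRamachandran2006, §1 Rem. 1.4] -/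
theorem IsEffectiveTwistSubspace.sup {i r : ℕ} {V₁ V₂ : Submodule K (E.obj X i)}
    (hV₁ : E.IsEffectiveTwistSubspace X i r V₁) (hV₂ : E.IsEffectiveTwistSubspace X i r V₂) :
    E.IsEffectiveTwistSubspace X i r (V₁ ⊔ V₂) := by
  obtain ⟨hst₁, Q₁, hQ₁m, hQ₁s, hQ₁⟩ := hV₁
  obtain ⟨hst₂, Q₂, hQ₂m, hQ₂s, hQ₂⟩ := hV₂
  obtain ⟨Q, hQm, hQs, hd₁, hd₂⟩ := exists_monic_squarefree_dvd_dvd hQ₁m hQ₂m hQ₁s hQ₂s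
  refine ⟨fun v hv ↦ ?_, ⟨Q, hQm, hQs, fun v hv ↦ ?_⟩⟩
  · obtain ⟨a, ha, b, hb, rfl⟩ := Submodule.mem_sup.mp hv
    rw [map_add]
    exact Submodule.add_mem_sup (hst₁ a ha) (hst₂ b hb)
  · obtain ⟨a, ha, b, hb, rfl⟩ := Submodule.mem_sup.mp hv
    rw [map_add, aeval_apply_eq_zero_of_dvd _ hd₁ (hQ₁ a ha),
      aeval_apply_eq_zero_of_dvd _ hd₂ (hQ₂ b hb), add_zero]

/-- The family of effective-twist subspaces is sup-closed. [cite: MilneRamachandran2006, §1 Rem. 1.4] -/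
theorem supClosed_setOf_isEffectiveTwistSubspace (X : SchemeOver k) (i r : ℕ) :
    SupClosed {V : Submodule K (E.obj X i) | E.IsEffectiveTwistSubspace X i r V} :=
  fun _ h₁ _ h₂ ↦ h₁.sup h₂

/-- **Over a finite field every `ρ(g)`, `g ∈ Γ_k`, commutes with `ϖ_r = (q⁻¹)^r • ρ(F)`** (`Γ_k` is
abelian; the tree's `commute_ρ`). [cite: SerreLocalFields1979, Ch. XIII §1] [cite: MilneRamachandran2006, §1.1] -/
theorem commute_ρ_smul_frobenius (X : SchemeOver k) (i r : ℕ) (g : Field.absoluteGaloisGroup k) :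
    Commute (E.ρ X i g) (((Nat.card k : K)⁻¹ ^ r) • E.frobenius X i) :=
  (E.commute_ρ X i g (geomFrob k)).smul_right _

variable {E} in
/-- **A Galois translate of an effective-twist subspace is an effective-twist subspace**: `ρ(g) V` is
`ϖ`-stable and killed by the same polynomial, because `ρ(g)` commutes with `ϖ` (finite field).
[cite: MilneRamachandran2006, §1 Rem. 1.4] [cite: SerreLocalFields1979, Ch. XIII §1] -/
theorem IsEffectiveTwistSubspace.map_ρ {i r : ℕ} {V : Submodule K (E.obj X i)}
    (hV : E.IsEffectiveTwistSubspace X i r V) (g : Field.absoluteGaloisGroup k) :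
    E.IsEffectiveTwistSubspace X i r (V.map (E.ρ X i g)) := by
  obtain ⟨hst, Q, hQm, hQs, hQ⟩ := hV
  have hc : Commute (E.ρ X i g) (E.frobenius X i) := E.commute_ρ X i g (geomFrob k)
  refine ⟨fun x hx ↦ ?_, ⟨Q, hQm, hQs, fun x hx ↦ ?_⟩⟩
  · obtain ⟨v, hv, rfl⟩ := Submodule.mem_map.mp hx
    refine Submodule.mem_map.mpr ⟨E.frobenius X i v, hst v hv, ?_⟩
    rw [← Module.End.mul_apply, hc.eq, Module.End.mul_apply]
  · obtain ⟨v, hv, rfl⟩ := Submodule.mem_map.mp hx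
    have hca := commute_aeval_of_commute (E.commute_ρ_smul_frobenius X i r g)
      (Q.map (Int.castRingHom K))
    rw [← Module.End.mul_apply, ← hca.eq, Module.End.mul_apply, hQ v hv, map_zero]

/-- **`F^r_b Hⁱ(X)` is `Γ_k`-stable**: `ρ(g) (F^r_b Hⁱ(X)) ⊆ F^r_b Hⁱ(X)` for every `g ∈ Γ_k` and every
`k`-scheme `X` (a supremum of effective-twist subspaces, whose Galois translates are again such).
Rem. 1.4: `F_b` is a Tate substructure; over a finite field the whole Galois group preserves it.
[cite: MilneRamachandran2006, §1 Rem. 1.4] [cite: Tate1994, §1] -/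
theorem map_ρ_frobIntegralPart_le (X : SchemeOver k) (i r : ℕ) (g : Field.absoluteGaloisGroup k) :
    (E.frobIntegralPart X i r).map (E.ρ X i g) ≤ E.frobIntegralPart X i r := by
  unfold frobIntegralPart
  rw [Submodule.map_iSup]
  refine iSup_le fun V ↦ ?_
  rw [Submodule.map_iSup]
  exact iSup_le fun hV ↦ E.le_frobIntegralPart (hV.map_ρ g)

/-- Pointwise: `x ∈ F^r_b Hⁱ(X) → ρ(g) x ∈ F^r_b Hⁱ(X)`. [cite: MilneRamachandran2006, §1 Rem. 1.4] [cite: Tate1994, §1] -/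
theorem ρ_apply_mem_frobIntegralPart {i r : ℕ} {x : E.obj X i} (hx : x ∈ E.frobIntegralPart X i r)
    (g : Field.absoluteGaloisGroup k) : E.ρ X i g x ∈ E.frobIntegralPart X i r :=
  E.map_ρ_frobIntegralPart_le X i r g (Submodule.mem_map_of_mem hx)

/-- The same for the twisted actions: `x ∈ F^r_b Hⁱ(X) → (χ(g)ʲ • ρ(g)) x ∈ F^r_b Hⁱ(X)`.
[cite: MilneRamachandran2006, §1 Rem. 1.4] [cite: Tate1994, §1] -/
theorem ρTwist_apply_mem_frobIntegralPart {i r : ℕ} (j : ℤ) {x : E.obj X i}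
    (hx : x ∈ E.frobIntegralPart X i r) (g : Field.absoluteGaloisGroup k) :
    E.ρTwist X i j g x ∈ E.frobIntegralPart X i r := by
  rw [ρTwist_apply]
  exact Submodule.smul_mem _ _ (E.ρ_apply_mem_frobIntegralPart hx g)

/-- **`F^r_b Hⁱ(X)` is a `Γ_k`-submodule of `Hⁱ(X)`**: it is an invariant submodule of every `ρ(g)`
(Mathlib `Module.End.invtSubmodule`). [cite: MilneRamachandran2006, §1 Rem. 1.4] [cite: Tate1994, §1] -/
theorem frobIntegralPart_mem_invtSubmodule_ρ (X : SchemeOver k) (i r : ℕ)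
    (g : Field.absoluteGaloisGroup k) :
    E.frobIntegralPart X i r ∈ Module.End.invtSubmodule (E.ρ X i g) :=
  fun _ hx ↦ E.ρ_apply_mem_frobIntegralPart hx g

/-! ### §3 Rem. 1.4 «the largest»: the supremum is attained; semisimplicity on `F^r_b Hⁱ(X)` -/

/-- `F^r_b Hⁱ(X)` is the supremum of the SET of effective-twist subspaces.
[cite: MilneRamachandran2006, §1 Rem. 1.4] -/
theorem frobIntegralPart_eq_sSup (X : SchemeOver k) (i r : ℕ) :
    E.frobIntegralPart X i r =
      sSup {V : Submodule K (E.obj X i) | E.IsEffectiveTwistSubspace X i r V} := by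
  rw [sSup_eq_iSup]
  rfl

/-- **REM. 1.4: `F^r_b Hⁱ(X)` is the LARGEST `ϖ`-stable subspace of `Hⁱ(X)` on which `ϖ_r` is killed by
a monic integer polynomial squarefree over `ℚ`** («the largest semisimple Tate substructure of
`Hⁱ_l(X)` whose twist by `ℚ_l(r)` is still effective»), `X` smooth projective over the finite field
`k`: the family of such subspaces is nonempty and closed under binary suprema, and in the
finite-dimensional `Hⁱ(X)` a nonempty sup-closed family of subspaces contains its supremum.
[cite: MilneRamachandran2006, §1 Rem. 1.4] -/
theorem isGreatest_frobIntegralPart (hX : IsSmoothProjective d X) (i r : ℕ) :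
    IsGreatest {V : Submodule K (E.obj X i) | E.IsEffectiveTwistSubspace X i r V}
      (E.frobIntegralPart X i r) := by
  haveI := E.finite_obj hX i
  refine ⟨?_, fun V hV ↦ E.le_frobIntegralPart hV⟩
  rw [E.frobIntegralPart_eq_sSup X i r]
  have hc := CompleteLattice.WellFoundedGT.isSupClosedCompact (Submodule K (E.obj X i))
    inferInstance
  exact hc _ ⟨⊥, E.isEffectiveTwistSubspace_bot X i r⟩
    (E.supClosed_setOf_isEffectiveTwistSubspace X i r)

/-- **`F^r_b Hⁱ(X)` is itself an effective-twist subspace** (`X` smooth projective; no Riemann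
hypothesis needed — compare `isEffectiveTwistSubspace_frobIntegralPart` of
`Motives/FrobIntegralPartEqFrobeniusPowerFixed`, for `i = 2r` under the Riemann hypothesis).
[cite: MilneRamachandran2006, §1 Rem. 1.4] -/
theorem isEffectiveTwistSubspace_frobIntegralPart_of_isSmoothProjective (hX : IsSmoothProjective d X)
    (i r : ℕ) : E.IsEffectiveTwistSubspace X i r (E.frobIntegralPart X i r) :=
  (E.isGreatest_frobIntegralPart hX i r).1

/-- **ONE monic integer polynomial, squarefree over `ℚ`, kills `ϖ_r` on all of `F^r_b Hⁱ(X)`** (`X`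
smooth projective). [cite: MilneRamachandran2006, §1 Rem. 1.4] -/
theorem exists_monic_squarefree_aeval_eq_zero_on_frobIntegralPart (hX : IsSmoothProjective d X)
    (i r : ℕ) :
    ∃ Q : ℤ[X], Q.Monic ∧ Squarefree (Q.map (Int.castRingHom ℚ)) ∧
      ∀ v ∈ E.frobIntegralPart X i r,
        aeval (((Nat.card k : K)⁻¹ ^ r) • E.frobenius X i) (Q.map (Int.castRingHom K)) v = 0 :=
  (E.isEffectiveTwistSubspace_frobIntegralPart_of_isSmoothProjective hX i r).2

/-- `ϖ_r = (q⁻¹)^r • ϖ` preserves `F^r_b Hⁱ(X)` (any `k`-scheme `X`). [cite: MilneRamachandran2006, §1 Rem. 1.4] -/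
theorem smul_frobenius_mem_frobIntegralPart {i r : ℕ} {x : E.obj X i}
    (hx : x ∈ E.frobIntegralPart X i r) :
    (((Nat.card k : K)⁻¹ ^ r) • E.frobenius X i) x ∈ E.frobIntegralPart X i r := by
  rw [LinearMap.smul_apply]
  exact Submodule.smul_mem _ _ (E.frobenius_mem_frobIntegralPart hx)

/-- **`ϖ_r` ACTS SEMISIMPLY ON `F^r_b Hⁱ(X)`** (`X` smooth projective): Rem. 1.4's «semisimple Tate
substructure» — the restriction of `ϖ_r` to `F^r_b Hⁱ(X)` is killed by a polynomial squarefree over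
`ℚ`, hence separable, hence squarefree over `K` (Mathlib `Module.End.isSemisimple_of_squarefree_aeval_eq_zero`).
[cite: MilneRamachandran2006, §1 Rem. 1.4 and §1.1] -/
theorem isSemisimple_restrict_smul_frobenius_frobIntegralPart (hX : IsSmoothProjective d X)
    (i r : ℕ) :
    Module.End.IsSemisimple
      (LinearMap.restrict (((Nat.card k : K)⁻¹ ^ r) • E.frobenius X i)
        (fun _ hx ↦ E.smul_frobenius_mem_frobIntegralPart hx :
          ∀ x ∈ E.frobIntegralPart X i r,
            (((Nat.card k : K)⁻¹ ^ r) • E.frobenius X i) x ∈ E.frobIntegralPart X i r)) := by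
  obtain ⟨Q, -, hQs, hQ⟩ := E.exists_monic_squarefree_aeval_eq_zero_on_frobIntegralPart hX i r
  refine Module.End.isSemisimple_of_squarefree_aeval_eq_zero (p := Q.map (Int.castRingHom K)) ?_ ?_
  · rw [← map_map_intCast_ratCast]
    exact ((PerfectField.separable_iff_squarefree.mpr hQs).map).squarefree
  · ext ⟨v, hv⟩
    rw [LinearMap.zero_apply, Submodule.coe_zero, coe_aeval_restrict_apply]
    exact hQ v hv

/-- **`ϖ` ACTS SEMISIMPLY ON `F^r_b Hⁱ(X)`** (`X` smooth projective): `ϖ = q^r • ϖ_r` on the stable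
subspace, and a nonzero scalar multiple of a semisimple endomorphism is semisimple.
[cite: MilneRamachandran2006, §1 Rem. 1.4 and §1.1] -/
theorem isSemisimple_restrict_frobenius_frobIntegralPart (hX : IsSmoothProjective d X) (i r : ℕ) :
    Module.End.IsSemisimple
      (LinearMap.restrict (E.frobenius X i)
        (fun _ hx ↦ E.frobenius_mem_frobIntegralPart hx :
          ∀ x ∈ E.frobIntegralPart X i r, E.frobenius X i x ∈ E.frobIntegralPart X i r)) := by
  have hq : ((Nat.card k : K)⁻¹ ^ r) ≠ 0 :=
    pow_ne_zero _ (inv_ne_zero (by exact_mod_cast Nat.card_pos.ne'))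
  have h := E.isSemisimple_restrict_smul_frobenius_frobIntegralPart hX i r
  have hres : LinearMap.restrict (((Nat.card k : K)⁻¹ ^ r) • E.frobenius X i)
      (fun _ hx ↦ E.smul_frobenius_mem_frobIntegralPart hx :
        ∀ x ∈ E.frobIntegralPart X i r,
          (((Nat.card k : K)⁻¹ ^ r) • E.frobenius X i) x ∈ E.frobIntegralPart X i r) =
      ((Nat.card k : K)⁻¹ ^ r) • LinearMap.restrict (E.frobenius X i)
        (fun _ hx ↦ E.frobenius_mem_frobIntegralPart hx :
          ∀ x ∈ E.frobIntegralPart X i r, E.frobenius X i x ∈ E.frobIntegralPart X i r) := by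
    ext ⟨v, hv⟩
    rfl
  rw [hres, Module.End.IsSemisimple_smul_iff hq] at h
  exact h

/-- **The twisted Frobenius `φ = E.ρTwist X i r (geomFrob k)` acts semisimply on `F^r_b Hⁱ(X)`**
(`χ(φ) = q`, `X` smooth projective; `φ = ϖ_r`). [cite: MilneRamachandran2006, §1 Rem. 1.4] [cite: Tate1994, §1] -/
theorem isSemisimple_restrict_ρTwist_frobIntegralPart (hχ : ((χ (arithFrob k) : Kˣ) : K) = Nat.card k)
    (hX : IsSmoothProjective d X) (i r : ℕ) :
    Module.End.IsSemisimple
      (LinearMap.restrict (E.ρTwist X i r (geomFrob k))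
        (fun _ hx ↦ E.ρTwist_apply_mem_frobIntegralPart r hx (geomFrob k) :
          ∀ x ∈ E.frobIntegralPart X i r,
            E.ρTwist X i r (geomFrob k) x ∈ E.frobIntegralPart X i r)) := by
  have h := E.isSemisimple_restrict_smul_frobenius_frobIntegralPart hX i r
  have heq : E.ρTwist X i r (geomFrob k) = ((Nat.card k : K)⁻¹ ^ r) • E.frobenius X i :=
    E.ρTwist_geomFrob_eq_smul_frobenius hχ X i r
  have hres : LinearMap.restrict (E.ρTwist X i r (geomFrob k))
      (fun _ hx ↦ E.ρTwist_apply_mem_frobIntegralPart r hx (geomFrob k) :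
        ∀ x ∈ E.frobIntegralPart X i r,
          E.ρTwist X i r (geomFrob k) x ∈ E.frobIntegralPart X i r) =
      LinearMap.restrict (((Nat.card k : K)⁻¹ ^ r) • E.frobenius X i)
        (fun _ hx ↦ E.smul_frobenius_mem_frobIntegralPart hx :
          ∀ x ∈ E.frobIntegralPart X i r,
            (((Nat.card k : K)⁻¹ ^ r) • E.frobenius X i) x ∈ E.frobIntegralPart X i r) := by
    ext ⟨v, hv⟩
    simp only [LinearMap.coe_restrict_apply, heq]
  rw [hres]
  exact h

/-- **Every effective-twist subspace carries a semisimple `ϖ_r`** (§1.1 «semisimple»: killed by a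
squarefree polynomial); in particular this holds on each `Ker(ϖ_r^N − 1)` and on the Tate classes.
[cite: MilneRamachandran2006, §1.1 and Rem. 1.4] -/
theorem IsEffectiveTwistSubspace.isSemisimple_restrict {i r : ℕ} {V : Submodule K (E.obj X i)}
    (hV : E.IsEffectiveTwistSubspace X i r V)
    (hV' : ∀ x ∈ V, (((Nat.card k : K)⁻¹ ^ r) • E.frobenius X i) x ∈ V) :
    Module.End.IsSemisimple (LinearMap.restrict (((Nat.card k : K)⁻¹ ^ r) • E.frobenius X i) hV') := by
  obtain ⟨Q, -, hQs, hQ⟩ := hV.2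
  refine Module.End.isSemisimple_of_squarefree_aeval_eq_zero (p := Q.map (Int.castRingHom K)) ?_ ?_
  · rw [← map_map_intCast_ratCast]
    exact ((PerfectField.separable_iff_squarefree.mpr hQs).map).squarefree
  · ext ⟨v, hv⟩
    rw [LinearMap.zero_apply, Submodule.coe_zero, coe_aeval_restrict_apply]
    exact hQ v hv

end GaloisWeilCohomology

end Literature.AlgebraicGeometry.Motives

end
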